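import Literature.AlgebraicGeometry.Motives.SubHodgeStructureDeterminantLineCriterion
import Literature.AlgebraicGeometry.HodgeTheory.VHSDataHodgeLocusOverPuncturedCompactCurve
import Literature.AlgebraicGeometry.Motives.FamiliesVHSProofs
import HarnessLib

/-!
# Cattani–Deligne–Kaplan, Corollary 1.4 for `VHSData`: the locus where some flat translate of a rational subspace `U ⊆ V_s` is a sub-Hodge
# structure is the determination locus of its `d`-vector `u₁ ∧ ⋯ ∧ u_d`; for a LINE it is the determination locus of its integral generator,
# hence ALL of the curve or FINITE over a punctured compact curve

Topic `Literature/AlgebraicGeometry/HodgeTheory` (namespace `Literature.AlgebraicGeometry.Motives.VHSData`), lane `lit-hodgefound` (seat `p08`,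
row g55-#4).  THEOREMS ONLY (no definition, no named fact, no instance; D-0026 net debt `0`).  The JUNCTION of the linear algebra of
`Motives/SubHodgeStructureDeterminantLineCriterion.lean` (a subspace underlies a sub-Hodge structure iff its top wedge is a Hodge class of `⋀ᵈ H`)
with the tree's `VHSData` (`Motives/FamiliesVHS`: local systems `V_ℤ ⊆ V`, parallel transport `D.V.transport γ`, pointwise Hodge structures
`D.hodge t`, `D.IsHodgeAt`) and the one-dimensional Cor. 1.3 over a punctured compact curve (`HodgeTheory/VHSDataHodgeLocusOverPuncturedCompactCurve`).

PRINTED SOURCE, VERBATIM (E. Cattani, P. Deligne, A. Kaplan, *On the locus of Hodge classes*, J. Amer. Math. Soc. 8 (1995) 483–506, p. 486; held text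
`paper:arxiv-alg-geom_9402009` p0001–p0002).  «**Corollary 1.4.** Let `𝒱` be a polarizable variation of Hodge structures on `S`, fix `s ∈ S` and let
`U_ℚ ⊂ (𝒱_s)_ℚ` be a rational subspace. The locus where some flat translate of `U_ℚ` is a Hodge substructure is an algebraic subvariety of `S`.
*Proof*: Let `T` be the locus in question, assumed non empty, and suppose first that `U_ℚ` is of dimension one. Then `𝒱` is of even weight `2p` so
that, replacing it by `𝒱(p)`, we may and shall assume it to be of weight `0`. Let `e` be a generator of `U_ℚ ∩ 𝒱_ℤ`. Then `U_ℚ` is a Hodge substructure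
if and only if `e` is of type `(0,0)`, and one applies 1.3.  Consider now the general case: `U` of dimension `n`. … A subspace `U_ℚ ⊂ H_ℚ` is a
sub-Hodge structure … if and only if `U_ℝ` is stable under `ℂ*`. This amounts to `⋀ⁿ U_ℝ ⊂ ⋀ⁿ H_ℝ` being stable under `ℂ*`, i.e., to `⋀ⁿ U_ℚ`
being a Hodge substructure of `⋀ⁿ H_ℚ`, and reduces us to the one-dimensional case, proving 1.4.»

* §1 **`exists_subHodgeStructure_translate_iff`** — POINTWISE COR. 1.4, any `d`: for `u : Fin d → V_s` linearly independent, `γ : s ⇝ t` and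
  `P + P = d·k`: the flat translate `γ · span(u) ⊆ V_t` underlies a sub-Hodge structure of `(V_t, F_t)` **iff**
  `⋀ᵈ(γ·)(u₁ ∧ ⋯ ∧ u_d) = γ·u₁ ∧ ⋯ ∧ γ·u_d` is a Hodge class of `⋀ᵈ V_t` of type `(P, P)`; odd `d·k` ⟹ never.
* §2 **`translateLocus_eq_setOf_exteriorPower`** — the LOCUS `T(U) = {t | ∃ γ : s ⇝ t, γ·U is a sub-Hodge structure of V_t}` equals
  `{t | ∃ γ, ⋀ᵈ(γ·)(u₁ ∧ ⋯ ∧ u_d) ∈ Hdg^P(⋀ᵈ V_t)}` («reduces us to the one-dimensional case» — the determination locus of the single vector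
  `u₁ ∧ ⋯ ∧ u_d` of `⋀ᵈ 𝒱_s`; the exterior-power VARIATION `⋀ᵈ 𝒱` as a `VHSData` is not in the tree, so the reduction stops at this equality).
* §3 **`exists_subHodgeStructure_translate_line_iff_isHodgeAt`**, **`translateLocus_line_eq_determinationLocus`** — `dim U_ℚ = 1`: for an integral
  `u₀ ≠ 0` the translate of the line `ℚ · u₀` along `γ` is a sub-Hodge structure iff the determination `γ · u₀` is of type `(p, p)` («`U_ℚ` is a Hodge
  substructure if and only if `e` is of type `(0,0)`»), so `T(ℚ · u₀)` IS the determination locus of `u₀` of Cor. 1.3.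
* §4 **`translateLocus_line_eq_univ_or_finite_of_compactification`** — COR. 1.4 (`dim U_ℚ = 1`, `r = 1`) over a PUNCTURED COMPACT CURVE: `T(ℚ · u₀)`
  is ALL of `S` or FINITE («and one applies 1.3»: the tree's `determinationLocus_eq_univ_or_finite_of_compactification`).

HONEST SCOPE.  `VHSData` records no holomorphy: the period charts of §4 are hypotheses (as in all one-dimensional CDK files of the tree).  The
general-`d` algebraicity needs `⋀ᵈ 𝒱` as a `VHSData` (not here); the Tate twist to weight `0` is replaced by the type `(P, P)`, `2P = d·k`.
Finite-dimensionality of the rational fibres is carried as the instance hypothesis `[∀ s, Module.Finite ℚ (D.V.fiber s)]` (the tree's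
convention, cf. `Motives/FamiliesVHSFiniteFiber`).

## References

* [CattaniDeligneKaplan1995] E. Cattani, P. Deligne, A. Kaplan, *On the locus of Hodge classes*, J. Amer. Math. Soc. 8 (1995) 483–506: Cor. 1.3,
  Cor. 1.4 and its proof (pp. 484–486).
* [Schmid1973] W. Schmid, *Variation of Hodge structure: the singularities of the period mapping*, Invent. Math. 22 (1973): §2 (cite only).
-/

noncomputable section

open scoped TensorProduct ComplexOrder
open _root_.Topology _root_.Filter Set

namespace Literature.AlgebraicGeometry

open Module
open Motives Motives.MixedHodgeStructure Motives.HodgeStructure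
open Motives.HodgeStructure (conj ofRat ofRat_apply conj_ofRat)
open HodgeTheory

universe u

namespace Motives.VHSData

variable {S : Type} [TopologicalSpace S] {k : ℤ} (D : VHSData S k) [hfin : ∀ s : S, Module.Finite ℚ (D.V.fiber s)]

/-! ## §1 Pointwise: a flat translate is a sub-Hodge structure iff the translate of the `d`-vector is a Hodge class -/

omit hfin in
/-- A linearly independent `u : Fin d → V_s` inside a `d`-dimensional `U` spans `U` (private plumbing). [folklore] -/
private theorem span_eq_of_linearIndependent_of_finrank_eq {s : S} {U : Submodule ℚ (D.V.fiber s)} [Module.Finite ℚ U] {d : ℕ}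
    {u : Fin d → D.V.fiber s} (hu : LinearIndependent ℚ u) (huU : ∀ i, u i ∈ U) (hd : Module.finrank ℚ U = d) :
    Submodule.span ℚ (Set.range u) = U :=
  Submodule.eq_of_le_of_finrank_eq (Submodule.span_le.2 (Set.range_subset_iff.2 huU))
    (by rw [finrank_span_eq_card hu, Fintype.card_fin, hd])

/-- **Cattani–Deligne–Kaplan, Cor. 1.4, POINTWISE, any dimension**: `D : VHSData S k`, `u : Fin d → V_s` linearly independent, `γ : s ⇝ t` a homotopy
class of paths and `P + P = d·k`.  **The flat translate `γ · span(u₁, …, u_d) ⊆ V_t` underlies a sub-Hodge structure of the Hodge structure of `V_t`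
if and only if `γ·u₁ ∧ ⋯ ∧ γ·u_d = ⋀ᵈ(γ·)(u₁ ∧ ⋯ ∧ u_d)` is a Hodge class of `⋀ᵈ V_t` of type `(P, P)`** («`U_ℚ` is a sub-Hodge structure … if
and only if … `⋀ⁿ U_ℚ` [is] a Hodge substructure of `⋀ⁿ H_ℚ`, and reduces us to the one-dimensional case»; parallel transport is injective).
[cite: CattaniDeligneKaplan1995, Cor. 1.4 and its proof (p. 486)] -/
theorem exists_subHodgeStructure_translate_iff {s t : S} (γ : Path.Homotopic.Quotient s t) {d : ℕ} {u : Fin d → D.V.fiber s}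
    (hu : LinearIndependent ℚ u) {P : ℤ} (hP : P + P = d * k) :
    (∃ W : SubHodgeStructure (D.hodge t), W.toSubmodule = (Submodule.span ℚ (Set.range u)).map (D.V.transport γ)) ↔
      exteriorPower.map d (D.V.transport γ) (exteriorPower.ιMulti ℚ d u) ∈ ((D.hodge t).exteriorPower d).hodgeClasses P :=
  HodgeStructure.exists_subHodgeStructure_map_span_iff_of_injective (H' := D.hodge t) (D.V.transport γ)
    (by rw [← LocalSystem.coe_transportEquiv]; exact (D.V.transportEquiv γ).injective) hu hP

/-- The same for a given rational subspace `U ⊆ V_s` of dimension `d` and a linearly independent `u : Fin d → V_s` inside it: **`γ · U` is a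
sub-Hodge structure of `V_t` iff `⋀ᵈ(γ·)(u₁ ∧ ⋯ ∧ u_d) ∈ Hdg^P(⋀ᵈ V_t)`** (`2P = d·k`). [cite: CattaniDeligneKaplan1995, Cor. 1.4 and its proof (p. 486)] -/
theorem exists_subHodgeStructure_translate_iff_of_finrank_eq {s t : S} (γ : Path.Homotopic.Quotient s t) {U : Submodule ℚ (D.V.fiber s)}
    {d : ℕ} {u : Fin d → D.V.fiber s} (hu : LinearIndependent ℚ u) (huU : ∀ i, u i ∈ U) (hd : Module.finrank ℚ U = d) {P : ℤ}
    (hP : P + P = d * k) :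
    (∃ W : SubHodgeStructure (D.hodge t), W.toSubmodule = U.map (D.V.transport γ)) ↔
      exteriorPower.map d (D.V.transport γ) (exteriorPower.ιMulti ℚ d u) ∈ ((D.hodge t).exteriorPower d).hodgeClasses P := by
  rw [← D.span_eq_of_linearIndependent_of_finrank_eq hu huU hd]
  exact D.exists_subHodgeStructure_translate_iff γ hu hP

/-- **No flat translate of a `d`-dimensional `U` is a sub-Hodge structure when `d·k` is odd** («Then `𝒱` is of even weight `2p`», for `d = 1`):
transport preserves the dimension and the determinant line of a sub-Hodge structure has even weight.
[cite: CattaniDeligneKaplan1995, proof of Cor. 1.4 (p. 486)] -/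
theorem not_exists_subHodgeStructure_translate_of_odd {s t : S} (γ : Path.Homotopic.Quotient s t) {U : Submodule ℚ (D.V.fiber s)} {d : ℕ}
    (hd : Module.finrank ℚ U = d) (hodd : Odd ((d : ℤ) * k)) :
    ¬ ∃ W : SubHodgeStructure (D.hodge t), W.toSubmodule = U.map (D.V.transport γ) := by
  refine HodgeStructure.not_exists_subHodgeStructure_of_odd (d := d) ?_ hodd
  rw [← hd, ← LocalSystem.coe_transportEquiv]
  exact (LinearEquiv.finrank_map_eq (D.V.transportEquiv γ) U)

/-! ## §2 The locus of Cor. 1.4 as the determination locus of the `d`-vector -/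

/-- **«Reduces us to the one-dimensional case»**: for `u : Fin d → V_s` linearly independent and `P + P = d·k`, the locus of Cor. 1.4
`T(span u) = {t ∈ S | ∃ γ : s ⇝ t, γ · span(u) underlies a sub-Hodge structure of V_t}` EQUALS the set of `t` where SOME determination of the
`d`-vector `u₁ ∧ ⋯ ∧ u_d ∈ ⋀ᵈ V_s` — transported by `⋀ᵈ` of the parallel transport — is a Hodge class of `⋀ᵈ V_t` of type `(P, P)`.
[cite: CattaniDeligneKaplan1995, Cor. 1.4 and its proof (p. 486)] -/
theorem translateLocus_eq_setOf_exteriorPower (s : S) {d : ℕ} {u : Fin d → D.V.fiber s} (hu : LinearIndependent ℚ u) {P : ℤ}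
    (hP : P + P = d * k) :
    {t : S | ∃ γ : Path.Homotopic.Quotient s t, ∃ W : SubHodgeStructure (D.hodge t),
        W.toSubmodule = (Submodule.span ℚ (Set.range u)).map (D.V.transport γ)} =
      {t : S | ∃ γ : Path.Homotopic.Quotient s t,
        exteriorPower.map d (D.V.transport γ) (exteriorPower.ιMulti ℚ d u) ∈ ((D.hodge t).exteriorPower d).hodgeClasses P} := by
  ext t
  exact exists_congr fun γ => D.exists_subHodgeStructure_translate_iff γ hu hP

/-- The locus for a given `U` (`dim U = d`, `u` a linearly independent family inside): `T(U) = {t | ∃ γ, ⋀ᵈ(γ·)(u₁ ∧ ⋯ ∧ u_d) ∈ Hdg^P(⋀ᵈ V_t)}`.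
[cite: CattaniDeligneKaplan1995, Cor. 1.4 and its proof (p. 486)] -/
theorem translateLocus_eq_setOf_exteriorPower_of_finrank_eq (s : S) {U : Submodule ℚ (D.V.fiber s)} {d : ℕ} {u : Fin d → D.V.fiber s}
    (hu : LinearIndependent ℚ u) (huU : ∀ i, u i ∈ U) (hd : Module.finrank ℚ U = d) {P : ℤ} (hP : P + P = d * k) :
    {t : S | ∃ γ : Path.Homotopic.Quotient s t, ∃ W : SubHodgeStructure (D.hodge t), W.toSubmodule = U.map (D.V.transport γ)} =
      {t : S | ∃ γ : Path.Homotopic.Quotient s t,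
        exteriorPower.map d (D.V.transport γ) (exteriorPower.ιMulti ℚ d u) ∈ ((D.hodge t).exteriorPower d).hodgeClasses P} := by
  rw [← D.span_eq_of_linearIndependent_of_finrank_eq hu huU hd]
  exact D.translateLocus_eq_setOf_exteriorPower s hu hP

/-- For odd `d·k` the locus of Cor. 1.4 of a `d`-dimensional `U` is EMPTY. [cite: CattaniDeligneKaplan1995, proof of Cor. 1.4 (p. 486)] -/
theorem translateLocus_eq_empty_of_odd (s : S) {U : Submodule ℚ (D.V.fiber s)} {d : ℕ} (hd : Module.finrank ℚ U = d)
    (hodd : Odd ((d : ℤ) * k)) :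
    {t : S | ∃ γ : Path.Homotopic.Quotient s t, ∃ W : SubHodgeStructure (D.hodge t), W.toSubmodule = U.map (D.V.transport γ)} = ∅ :=
  Set.eq_empty_of_forall_notMem fun _ ⟨γ, hW⟩ => D.not_exists_subHodgeStructure_translate_of_odd γ hd hodd hW

/-! ## §3 Dimension one: the translate of the line `ℚ · u₀` is a sub-Hodge structure iff the determination of `u₀` is of type `(p, p)` -/

omit hfin in
/-- The rational image of a nonzero integral vector is nonzero (the tree's `toRat_injective_holds`). [cite: Schmid1973, §2] -/
theorem toRat_ne_zero {s : S} {u₀ : D.VZ.fiber s} (hu₀ : u₀ ≠ 0) : D.toRat s u₀ ≠ 0 := fun h =>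
  hu₀ (D.toRat_injective_holds s (by rw [h, map_zero]))

omit hfin in
/-- Integral parallel transport is injective: `γ · u₀ ≠ 0` for `u₀ ≠ 0`. [cite: Schmid1973, §2] -/
theorem transport_ne_zero {s t : S} (γ : Path.Homotopic.Quotient s t) {u₀ : D.VZ.fiber s} (hu₀ : u₀ ≠ 0) : D.VZ.transport γ u₀ ≠ 0 := by
  rw [← LocalSystem.coe_transportEquiv]
  exact (D.VZ.transportEquiv γ).map_ne_zero_iff.2 hu₀

omit hfin in
/-- The flat translate of the line `ℚ · u₀` along `γ` is the line through the determination `γ · u₀` (`toRat` commutes with transport).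
[cite: CattaniDeligneKaplan1995, proof of Cor. 1.4 (p. 486)] -/
theorem map_transport_span_toRat {s t : S} (γ : Path.Homotopic.Quotient s t) (u₀ : D.VZ.fiber s) :
    (ℚ ∙ D.toRat s u₀).map (D.V.transport γ) = ℚ ∙ D.toRat t (D.VZ.transport γ u₀) := by
  rw [Submodule.map_span, Set.image_singleton, transport_toRat]

/-- **Cor. 1.4, `dim U_ℚ = 1`, pointwise** («Let `e` be a generator of `U_ℚ ∩ 𝒱_ℤ`. Then `U_ℚ` is a Hodge substructure if and only if `e` is of type
`(0,0)`»): for an integral `u₀ ≠ 0` at `s`, `γ : s ⇝ t` and `p + p = k`, **the flat translate `γ · (ℚ · u₀) ⊆ V_t` underlies a sub-Hodge structure iff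
the determination `γ · u₀ ∈ V_ℤ,t` is of type `(p, p)`** (`D.IsHodgeAt t p (γ · u₀)`). [cite: CattaniDeligneKaplan1995, proof of Cor. 1.4 (p. 486)] -/
theorem exists_subHodgeStructure_translate_line_iff_isHodgeAt {s t : S} (γ : Path.Homotopic.Quotient s t) {u₀ : D.VZ.fiber s} (hu₀ : u₀ ≠ 0)
    {p : ℤ} (hpk : p + p = k) :
    (∃ W : SubHodgeStructure (D.hodge t), W.toSubmodule = (ℚ ∙ D.toRat s u₀).map (D.V.transport γ)) ↔
      D.IsHodgeAt t p (D.VZ.transport γ u₀) := by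
  rw [D.map_transport_span_toRat γ u₀]
  exact HodgeStructure.exists_subHodgeStructure_span_singleton_iff_mem_hodgeClasses (H := D.hodge t)
    (D.toRat_ne_zero (D.transport_ne_zero γ hu₀)) hpk

/-- **The locus of Cor. 1.4 of the LINE `ℚ · u₀` IS the determination locus of `u₀` of Cor. 1.3**:
`{t | ∃ γ : s ⇝ t, γ · (ℚ · u₀) is a sub-Hodge structure of V_t} = {t | ∃ γ : s ⇝ t, γ · u₀ is of type (p, p)}` («and one applies 1.3»).
[cite: CattaniDeligneKaplan1995, Cor. 1.3 (p. 484) and proof of Cor. 1.4 (p. 486)] -/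
theorem translateLocus_line_eq_determinationLocus (s : S) {u₀ : D.VZ.fiber s} (hu₀ : u₀ ≠ 0) {p : ℤ} (hpk : p + p = k) :
    {t : S | ∃ γ : Path.Homotopic.Quotient s t, ∃ W : SubHodgeStructure (D.hodge t),
        W.toSubmodule = (ℚ ∙ D.toRat s u₀).map (D.V.transport γ)} =
      {t : S | ∃ γ : Path.Homotopic.Quotient s t, D.IsHodgeAt t p (D.VZ.transport γ u₀)} := by
  ext t
  exact exists_congr fun γ => D.exists_subHodgeStructure_translate_line_iff_isHodgeAt γ hu₀ hpk

/-- The base point lies in the locus iff `ℚ · u₀` itself is a sub-Hodge structure of `V_s`, iff `u₀` is of type `(p, p)` at `s` (translate along the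
constant path). [cite: CattaniDeligneKaplan1995, proof of Cor. 1.4 (p. 486)] -/
theorem exists_subHodgeStructure_line_iff_isHodgeAt (s : S) {u₀ : D.VZ.fiber s} (hu₀ : u₀ ≠ 0) {p : ℤ} (hpk : p + p = k) :
    (∃ W : SubHodgeStructure (D.hodge s), W.toSubmodule = ℚ ∙ D.toRat s u₀) ↔ D.IsHodgeAt s p u₀ :=
  HodgeStructure.exists_subHodgeStructure_span_singleton_iff_mem_hodgeClasses (H := D.hodge s) (D.toRat_ne_zero hu₀) hpk

/-! ## §4 Cor. 1.4 (`dim U_ℚ = 1`) over a punctured compact curve: the locus is everything or finite -/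

variable {V : Type u} [AddCommGroup V] [Module ℚ V] [FiniteDimensional ℚ V]
variable {X : Type*} [TopologicalSpace X] [CompactSpace X]

/-- **Cattani–Deligne–Kaplan, COROLLARY 1.4 for a rational LINE, for `D : VHSData S k` (`k = p + p`) over a PUNCTURED COMPACT CURVE.**  `u₀ ∈ V_ℤ,s₀`
integral and nonzero, `U_ℚ = ℚ · u₀ ⊆ V_{s₀}`; the hypotheses of the tree's Cor. 1.3 over a punctured compact curve
(`determinationLocus_eq_univ_or_finite_of_compactification`: `S` preconnected, flat interior charts with a metric comparison, flat unipotent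
puncture charts `Lᵢ, Γᵢ, Λᵢ, σᵢ, eᵢ`, the compact `X ⊇ j(S)` with disc charts `φ i` centred at the punctures `pt i` and `j (σ i z) = (φ i)⁻¹(e^{2πiz})`).
Then **the locus `{t ∈ S | some flat translate of U_ℚ to V_t is a sub-Hodge structure}` is ALL of `S` or a FINITE set** («is an algebraic
subvariety of `S`»: «`U_ℚ` is a Hodge substructure if and only if `e` is of type `(0,0)`, and one applies 1.3»).
[cite: CattaniDeligneKaplan1995, Cor. 1.4 and its proof (p. 486), Cor. 1.3 (p. 484), «Proof of 1.5 ⟹ 1.1» (p. 485)] [cite: Schmid1973, §2 (cite only)] -/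
theorem translateLocus_line_eq_univ_or_finite_of_compactification [PreconnectedSpace S] {p : ℤ} (hpk : p + p = k) {s₀ : S}
    {u₀ : D.VZ.fiber s₀} (hu₀ : u₀ ≠ 0)
    -- flat interior charts at every point
    (hint : ∀ x : S, ∃ ψ : OpenPartialHomeomorph S ℂ, x ∈ ψ.source ∧ IsPreconnected ψ.target ∧
      ∃ (e : ∀ c : ℂ, D.V.fiber (ψ.symm c) ≃ₗ[ℚ] V) (H₀ : HodgeStructure V k) (P₀ : H₀.Polarization) (h : ℂ → Module.End ℂ (ℂ ⊗[ℚ] V))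
        (Λ₀ : Submodule ℤ V) (κ : ℝ),
        (∀ (φ : Module.Dual ℂ (ℂ ⊗[ℚ] V)) (w : ℂ ⊗[ℚ] V), AnalyticOnNhd ℂ (fun c => φ (h c w)) ψ.target) ∧
        (∀ c ∈ ψ.target, ((D.hodge (ψ.symm c)).F p).map ((e c).toLinearMap.baseChange ℂ) = (H₀.F p).comap (h c)) ∧
        Λ₀.FG ∧ (∀ c ∈ ψ.target, ∀ u : D.VZ.fiber (ψ.symm c), e c (D.toRat (ψ.symm c) u) ∈ Λ₀) ∧
        0 < κ ∧ (∀ c ∈ ψ.target, ∀ x : D.V.fiber (ψ.symm c), κ * P₀.hodgeNorm (ofRat (e c x)) ≤ (D.form (ψ.symm c)).hodgeNorm (ofRat x)) ∧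
        (∀ c ∈ ψ.target, ∀ c' ∈ ψ.target, ∃ δ : Path.Homotopic.Quotient (ψ.symm c) (ψ.symm c'),
          ∀ y : D.V.fiber (ψ.symm c), e c' (D.V.transport δ y) = e c y))
    -- flat puncture charts
    {ι : Type*} (L : ι → PolarizedLimitMixedHodgeStructure V k) (Γ : ι → ℂ → Module.End ℂ (ℂ ⊗[ℚ] V)) (hΓ0 : ∀ i, Γ i 0 = 0)
    (hΓan : ∀ (i : ι) (φ : Module.Dual ℂ (ℂ ⊗[ℚ] V)) (w : ℂ ⊗[ℚ] V), AnalyticAt ℂ (fun s => φ (Γ i s w)) 0)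
    (hΓb : ∀ (i : ι) (s : ℂ), Γ i s ∈ ⨆ ab ∈ {ab : ℤ × ℤ | ab.1 ≤ -1}, (L i).toMixedHodgeStructure.endPiece ab.1 ab.2)
    (Λ : ι → Submodule ℤ V) (hΛ : ∀ i, (Λ i).FG) (hΛT : ∀ i, ∀ u ∈ Λ i, (L i).monodromy u ∈ Λ i)
    (σ : ι → ℂ → S) (e : ∀ (i : ι) (z : ℂ), D.V.fiber (σ i z) ≃ₗ[ℚ] V) (A₀ : ι → ℝ)
    (hF : ∀ (i : ι) (z : ℂ), A₀ i ≤ z.im → ((D.hodge (σ i z)).F p).map ((e i z).toLinearMap.baseChange ℂ) =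
      (((L i).F p).map (IsNilpotent.exp (Γ i (Complex.exp (2 * Real.pi * Complex.I * z))))).map (IsNilpotent.exp (z • (L i).N.baseChange ℂ)))
    (hQ : ∀ (i : ι) (z : ℂ), A₀ i ≤ z.im → ∀ x y : D.V.fiber (σ i z), (D.form (σ i z)).form x y = (L i).Q (e i z x) (e i z y))
    (hΛ₁ : ∀ (i : ι) (z : ℂ), A₀ i ≤ z.im → ∀ u : D.VZ.fiber (σ i z), e i z (D.toRat (σ i z) u) ∈ Λ i)
    (hflat : ∀ (i : ι) (z z' : ℂ), A₀ i ≤ z.im → A₀ i ≤ z'.im → ∃ δ : Path.Homotopic.Quotient (σ i z) (σ i z'),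
      ∀ y : D.V.fiber (σ i z), e i z' (D.V.transport δ y) = e i z y)
    -- the compactification with disc charts at the punctures
    {j : S → X} (hj : IsEmbedding j) (pt : ι → X) (hpS : ∀ i, pt i ∉ range j) (hcov : ∀ x : X, x ∉ range j → ∃ i, x = pt i)
    (φ : ι → OpenPartialHomeomorph X ℂ) (hp : ∀ i, pt i ∈ (φ i).source) (hφp : ∀ i, φ i (pt i) = 0)
    (hball : ∀ i, Metric.ball (0 : ℂ) (Real.exp (-(2 * Real.pi * A₀ i))) ⊆ (φ i).target)
    (hσ : ∀ (i : ι) (z : ℂ), A₀ i < z.im → j (σ i z) = (φ i).symm (Complex.exp (2 * Real.pi * Complex.I * z))) :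
    {t : S | ∃ γ : Path.Homotopic.Quotient s₀ t, ∃ W : SubHodgeStructure (D.hodge t),
        W.toSubmodule = (ℚ ∙ D.toRat s₀ u₀).map (D.V.transport γ)} = univ ∨
      {t : S | ∃ γ : Path.Homotopic.Quotient s₀ t, ∃ W : SubHodgeStructure (D.hodge t),
        W.toSubmodule = (ℚ ∙ D.toRat s₀ u₀).map (D.V.transport γ)}.Finite := by
  rw [D.translateLocus_line_eq_determinationLocus s₀ hu₀ hpk]
  exact D.determinationLocus_eq_univ_or_finite_of_compactification hpk u₀ hint L Γ hΓ0 hΓan hΓb Λ hΛ hΛT σ e A₀ hF hQ hΛ₁ hflat hj pt hpS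
    hcov φ hp hφp hball hσ

/-- **Cor. 1.4 for a line over a punctured compact curve, read off**: if the translate locus of `ℚ · u₀` is infinite, it is all of `S` — some flat
translate of `ℚ · u₀` to EVERY fibre is a sub-Hodge structure. [cite: CattaniDeligneKaplan1995, Cor. 1.4 (p. 486)] -/
theorem translateLocus_line_eq_univ_of_infinite {p : ℤ} {s₀ : S} {u₀ : D.VZ.fiber s₀}
    (h : {t : S | ∃ γ : Path.Homotopic.Quotient s₀ t, ∃ W : SubHodgeStructure (D.hodge t),
        W.toSubmodule = (ℚ ∙ D.toRat s₀ u₀).map (D.V.transport γ)} = univ ∨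
      {t : S | ∃ γ : Path.Homotopic.Quotient s₀ t, ∃ W : SubHodgeStructure (D.hodge t),
        W.toSubmodule = (ℚ ∙ D.toRat s₀ u₀).map (D.V.transport γ)}.Finite)
    (hinf : {t : S | ∃ γ : Path.Homotopic.Quotient s₀ t, ∃ W : SubHodgeStructure (D.hodge t),
        W.toSubmodule = (ℚ ∙ D.toRat s₀ u₀).map (D.V.transport γ)}.Infinite) (hp : p + p = k) :
    ∀ t : S, ∃ γ : Path.Homotopic.Quotient s₀ t, D.IsHodgeAt t p (D.VZ.transport γ u₀) := by
  intro t
  have ht : t ∈ {t : S | ∃ γ : Path.Homotopic.Quotient s₀ t, ∃ W : SubHodgeStructure (D.hodge t),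
      W.toSubmodule = (ℚ ∙ D.toRat s₀ u₀).map (D.V.transport γ)} := by
    rw [h.resolve_right hinf]; exact mem_univ t
  obtain ⟨γ, hW⟩ := ht
  by_cases hu₀ : u₀ = 0
  · subst hu₀
    exact ⟨γ, by rw [map_zero]; exact D.isHodgeAt_zero t p⟩
  · exact ⟨γ, (D.exists_subHodgeStructure_translate_line_iff_isHodgeAt γ hu₀ hp).1 hW⟩

end Motives.VHSData

end Literature.AlgebraicGeometry

end
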